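import Literature.NumberTheory.Automorphic.LanglandsTunnellTwist
import Literature.NumberTheory.Automorphic.TunnellOctahedralGlobalProofs
import Literature.NumberTheory.GaloisRepresentations.ArtinCharacterReciprocityProofs
import HarnessLib

/-!
# The cuspidality of Tunnell's cubic lifts is equivalent to Tunnell's Lemma

Topic `NumberTheory/Automorphic` (trunk AutomorphicL, family `lang`). Pure proof file: everything
here is PROVED (no `sorry`, no definition, no new named fact, nothing restated).

The named fact `Literature.NumberTheory.Automorphic.tunnell_cuspidal_cubic_lifts` (`TunnellLemma`;
Tunnell, *Artin's conjecture for representations of octahedral type*, Bull. AMS 5 (1981),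
Theorem [4] = Jacquet–Piatetski-Shapiro–Shalika's non-normal cubic base change, and Gelbart 1997,
§7.2, Lemma p. 259: in Tunnell's setting — `σ` octahedral, `E/F` the quadratic `A_4`-field, `K/F` a
cubic `D_4`-field — every cuspidal `π` on `GL_2(𝔸_F)` lifting weakly to `π(σ_E)` has a **cuspidal**
weak base change lift to `GL_2(𝔸_K)`) is the one leaf of the tree's decomposition of Tunnell's
theorem whose printed proof (the `GL(3)` and `GL(2) × GL(3)` theory behind the C. R. note of
Jacquet–Piatetski-Shapiro–Shalika) has no carrier in the tree. The tree proves Tunnell's Lemma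
from it (`tunnell_lemma_of_leaves`, `LanglandsTunnellReduction`: fibres of quadratic base change
`ArthurClozel_fibres_quadratic` + this fact ⇒ `tunnell_lemma`). This file proves the **converse
reduction**, so that the exact weight of the leaf inside the decomposition is a checked statement:

* `tunnell_cuspidal_cubic_lifts_of_tunnell_lemma` — **Tunnell's Lemma and the dihedral case of the
  strong Artin conjecture imply the cuspidality fact.** Given `π` lifting weakly to `Π_E = π(σ_E)`:
  `σ_K` is irreducible of dihedral type `D_4` (`isDihedralType_restrictField_of_card_eq_eight`: a
  subgroup of order `8` of `S_4` is a `2`-Sylow subgroup, conjugate to the dihedral one), so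
  `Π_K = π(σ_K)` is cuspidal (`strongArtin_of_isDihedralType`, Jacquet–Langlands §12); the twist
  `π₂ = π ⊗ ω_{E/F}` (a theorem of the tree, `exists_twist_quadraticSign_holds`) lifts to `Π_E` too;
  by Tunnell's Lemma (p. 174: "there exists a unique index `i` such that `BC_{K/F}(π_i) = π(ρ_K)`")
  either `π` lifts weakly to `Π_K` — done — or `π₂` does, and then `π = π₂ ⊗ ω_{E/F}` lifts weakly
  to the cuspidal twist `Π_K ⊗ (ω_{E/F} ∘ N_{K/F})`, because
  `t_{Π_K ⊗ ω, w} = ε_{E/F}(v)^{f(w|v)} (ε_{E/F}(v) t_{π,v})^{f(w|v)} = t_{π,v}^{f(w|v)}`. The Hecke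
  character `ω_{E/F} ∘ N_{K/F}` of the **non-normal** `K` is obtained on the Galois side
  (`exists_heckeCharacter_quadraticSign_pow`): restrict the quadratic Artin character `χ_{E/F}` to
  `Γ_K` and apply Artin reciprocity for characters over `K`, a theorem of the tree
  (`GaloisRepresentations.artinReciprocity_character_holds`); its value at `ϖ_w` is
  `χ_{E/F}(Frob_w) = χ_{E/F}(Frob_v)^{f(w|v)} = ε_{E/F}(v)^{f(w|v)}`
  (`exists_artinChar_frob_eq_quadraticSign`: a Frobenius inside `Gal(F̄/E)` means `v` splits, one
  outside means `v` is inert, `GaloisRepresentations/FrobeniusPlaces`).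
* `tunnell_cuspidal_cubic_lifts_iff_tunnell_lemma` — granting Arthur–Clozel's Thm. III.3.1
  (`ArthurClozel_fibres_quadratic`) and the dihedral case (`strongArtin_of_isDihedralType`), the
  named facts `tunnell_cuspidal_cubic_lifts` and `tunnell_lemma` are **equivalent**;
  `tunnell_cuspidal_cubic_lifts_of_tunnell_lemma_of_induction` — the same over the finer leaf
  `automorphicInduction_character` (the dihedral case being reduced to it and to Artin reciprocity
  in `LanglandsTunnellMonomial`).
* `tunnell_lemma_of_strongArtin_of_isOctahedralType` — **the octahedral case implies Tunnell's
  Lemma** given the fibres of quadratic base change: `π(σ)` lifts weakly to `π(σ_E)` and to `π(σ_K)`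
  (`isWeakBaseChangeLiftAE_of_isPiOfArtinRep`, any extension), so by Arthur–Clozel III.3.1 over
  `E/F` one of `π₁, π₂` has the Satake parameters of `π(σ)` almost everywhere and lifts to `π(σ_K)`
  (`IsWeakBaseChangeLiftAE.of_eventually_hasSatakeParamAt`); with the tree's
  `strongArtin_of_isOctahedralType_of_tunnell_lemma` this gives
  `strongArtin_of_isOctahedralType_iff_tunnell_lemma` (granting the tetrahedral and dihedral cases,
  cyclic descent and the fibres), and `tunnell_cuspidal_cubic_lifts_of_strongArtin_of_isOctahedralType`
  closes the triangle: modulo those standard facts the three named facts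
  `strongArtin_of_isOctahedralType`, `tunnell_lemma`, `tunnell_cuspidal_cubic_lifts` are equivalent.

Consequence for the trust base (D-0026 bookkeeping, no new fact): the leaf
`tunnell_cuspidal_cubic_lifts` is implied by Tunnell's printed Lemma together with Jacquet–Langlands'
dihedral case, and implies it given Arthur–Clozel III.3.1; it carries exactly the content of the
non-normal cubic base change used on p. 174 of Tunnell's note, neither more nor less.

## Design notes

* Satake-level ("weak", almost-everywhere) conventions of `TunnellOctahedralGlobal`/`TunnellLemma`;
  the two Satake facts of Flath are the theorems `AutomorphicRepData.hasSatakeParamAt_unique_holds`,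
  `…_cofinite_holds`.
* No base change of Hecke characters along the non-Galois `K/F` is needed (the tree's
  `HeckeCharacter.baseChange` is for Galois extensions): the character `ω_{E/F} ∘ N_{K/F}` is
  produced from `χ_{E/F}|_{Γ_K}` by Artin reciprocity over `K`, and only its values at almost all
  uniformizers are used.
* Mathlib: `Sylow.ofCard`, `Sylow.equiv` (conjugacy of Sylow subgroups), `Ideal.inertiaDeg`,
  `Filter.cofinite`; the quadratic character `χ_{E/F}` is `signCharOfIndexTwo` of
  `LanglandsTetrahedral` as in `LanglandsTunnellTwist`, whose split/inert computation is repeated here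
  pointwise in the Frobenius (that file only exports the resulting Hecke character over `F`).

## References

* J. Tunnell, *Artin's conjecture for representations of octahedral type*, Bull. AMS (N.S.) 5
  (1981), 173–175: Theorem [4] (p. 173), Lemma (p. 174). [Tunnell1981]
* S. Gelbart, *Three lectures on the modularity of `ρ̄_{E,3}` and the Langlands reciprocity
  conjecture*, in *Modular Forms and Fermat's Last Theorem* (1997), §7.2, Proposition (p. 258) and
  Lemma (p. 259). [Gelbart1997]
* H. Jacquet, I. I. Piatetski-Shapiro, J. Shalika, *Relèvement cubique non normal*, C. R. Acad.
  Sci. Paris Sér. I 292 (1981), 567–571 (not held; acquisition requested). [JPSS1981Cubique]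
* H. Jacquet, R. P. Langlands, *Automorphic Forms on GL(2)*, LNM 114 (1970), §12.
  [JacquetLanglands1970]
* J. Tate, *Global class field theory*, in Cassels–Fröhlich (1967), Ch. VII §4.2, §5.1.
  [CasselsFrohlichANT1967]
-/

noncomputable section

open scoped MatrixGroups NumberField Polynomial
open NumberField IsDedekindDomain Field Polynomial Filter

namespace Literature.NumberTheory.Automorphic

/-! ### Subgroups of order `8` of `S_4` and the dihedral type of `σ|_{Γ_K}` -/

section OrderEight

open Literature.NumberTheory.GaloisRepresentations

/-- **In a group `P ≅ S_4` every subgroup of order `8` is isomorphic to `D_4`**: it is a `2`-Sylow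
subgroup (`|S_4| = 24 = 2³·3`, Mathlib `Sylow.ofCard`), and the `2`-Sylow subgroups are conjugate
(`Sylow.equiv`) to the dihedral one of `exists_subgroup_mulEquiv_dihedralGroup_of_mulEquiv_perm`.
[folklore] -/
theorem nonempty_mulEquiv_dihedralGroup_four_of_card_eq_eight {P : Type*} [Group P]
    (e : P ≃* Equiv.Perm (Fin 4)) (H : Subgroup P) (hH : Nat.card H = 8) :
    Nonempty (H ≃* DihedralGroup 4) := by
  classical
  haveI : Finite P := Finite.of_equiv _ e.toEquiv.symm
  haveI : Fact (Nat.Prime 2) := ⟨Nat.prime_two⟩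
  haveI : Finite (Sylow 2 P) :=
    Finite.of_injective (SetLike.coe : Sylow 2 P → Set P) SetLike.coe_injective
  obtain ⟨Q, -, hQ, ⟨eQ⟩⟩ := exists_subgroup_mulEquiv_dihedralGroup_of_mulEquiv_perm e
  have hP : Nat.card P = 24 := by
    rw [Nat.card_congr e.toEquiv, Nat.card_perm, Nat.card_eq_fintype_card, Fintype.card_fin]
    rfl
  have hfac : (Nat.card P).factorization 2 = 3 := by
    rw [hP, show (24 : ℕ) = 2 ^ 3 * 3 from rfl, Nat.factorization_mul (by norm_num) (by norm_num),
      Finsupp.add_apply, Nat.Prime.factorization_pow Nat.prime_two, Finsupp.single_eq_same,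
      Nat.factorization_eq_zero_of_not_dvd (by norm_num : ¬ 2 ∣ 3)]
  let SH : Sylow 2 P := Sylow.ofCard H (by rw [hH, hfac]; norm_num)
  let SQ : Sylow 2 P := Sylow.ofCard Q (by rw [hQ, hfac]; norm_num)
  exact ⟨(Sylow.equiv SH SQ).trans eQ⟩

variable {F : Type} [Field F] [NumberField F]

omit [NumberField F] in
/-- **In Tunnell's setting `σ|_{Γ_K}` is irreducible of dihedral type `D_4`** (Tunnell 1981,
p. 174: "`K/F`, the cubic subextension cut out by a `2`-Sylow subgroup … `ρ_K` is monomial"): if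
`\bar σ(Γ_F) ≅ S_4` and `\bar σ(Γ_K)` has order `8`, then `\bar σ(Γ_K) ≅ D_4`
(`nonempty_mulEquiv_dihedralGroup_four_of_card_eq_eight` inside `\bar σ(Γ_F)`), which is not
cyclic, so `σ|_{Γ_K}` is irreducible (`isIrreducible_of_not_isCyclicType`). [cite: Tunnell1981, p. 174] -/
theorem isDihedralType_restrictField_of_card_eq_eight (σ : FramedArtinRep F 2)
    (e : projectiveImage σ.toMonoidHom ≃* Equiv.Perm (Fin 4))
    (K : Type) [Field K] [NumberField K] [Algebra F K]
    (hcardK : Nat.card (projectiveImage (σ.restrictField K).toMonoidHom) = 8) :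
    IsDihedralType (σ.restrictField K).toMonoidHom ∧
      (σ.restrictField K).toGaloisRep.IsIrreducible := by
  have hle : projectiveImage (σ.restrictField K).toMonoidHom ≤ projectiveImage σ.toMonoidHom :=
    projectiveImage_restrictField_le σ
  have eH : projectiveImage (σ.restrictField K).toMonoidHom ≃*
      (projectiveImage (σ.restrictField K).toMonoidHom).subgroupOf (projectiveImage σ.toMonoidHom) :=
    (Subgroup.subgroupOfEquivOfLe hle).symm
  have hH8 : Nat.card ((projectiveImage (σ.restrictField K).toMonoidHom).subgroupOf
      (projectiveImage σ.toMonoidHom)) = 8 := by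
    rw [← Nat.card_congr eH.toEquiv, hcardK]
  obtain ⟨eD⟩ := nonempty_mulEquiv_dihedralGroup_four_of_card_eq_eight e _ hH8
  have e8 : projectiveImage (σ.restrictField K).toMonoidHom ≃* DihedralGroup 4 := eH.trans eD
  haveI : Finite (σ.restrictField K).toMonoidHom.range := finite_range_toMonoidHom _
  exact ⟨⟨4, by norm_num, ⟨e8⟩⟩, (isIrreducible_toStdRepresentation_iff _).mp
    (isIrreducible_of_not_isCyclicType _ (not_isCyclicType_of_mulEquiv_dihedralGroup_four e8))⟩

end OrderEight

/-! ### The quadratic Artin character `χ_{E/F}`, its Frobenius values, and `ω_{E/F} ∘ N_{K/F}` -/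

section QuadraticCharacter

open Literature.NumberTheory.GaloisRepresentations

variable {F : Type} [Field F] [NumberField F]

/-- `1 × 1` matrices: `(M^k)₀₀ = (M₀₀)^k`. [folklore] -/
theorem matrix_fin_one_pow_apply {R : Type*} [CommRing R] (M : Matrix (Fin 1) (Fin 1) R) (k : ℕ) :
    (M ^ k) 0 0 = (M 0 0) ^ k := by
  induction k with
  | zero => simp
  | succ k ih => rw [pow_succ, Matrix.mul_apply, Fin.sum_univ_one, ih, pow_succ]

/-- **The quadratic Galois character `χ_{E/F}` and its Frobenius values** (class field theory is not
needed for this half: Tate, Cassels–Fröhlich Ch. VII §4.2; Neukirch I (9.3)–(9.5)). For a quadratic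
extension `E/F` of number fields there is a rank-one Artin representation `ψ = χ_{E/F}` of `Γ_F`
(kernel `Gal(F̄/E)`, `signCharOfIndexTwo`) such that at almost every finite place `v` of `F`
(namely `v` unramified in `E` and for `ψ`), `ψ` is unramified and **every** arithmetic Frobenius `Φ`
at every prime of `\bar ℤ_F` above `v` has `ψ(Φ) = ε_{E/F}(v)` (`quadraticSign`): `Φ ∈ Gal(F̄/E)`
forces all places of `E` above `v` to have residue degree `1` (`exists_places_split_of_mem_range`),
`Φ ∉ Gal(F̄/E)` forces a single place of degree `2` (`exists_place_inert_of_not_mem_range`). This is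
the pointwise-in-`Φ` form of the computation inside `exists_heckeCharacter_quadraticSign`
(`LanglandsTunnellTwist`). [cite: CasselsFrohlichANT1967, Ch. VII §4.2 and §5.1] -/
theorem exists_artinChar_frob_eq_quadraticSign (E : Type) [Field E] [NumberField E] [Algebra F E]
    (h2 : Module.finrank F E = 2) :
    ∃ ψ : FramedArtinRep F 1,
      ∀ᶠ v : HeightOneSpectrum (𝓞 F) in Filter.cofinite, ψ.IsUnramifiedAt v ∧
        ∀ 𝔓 ∈ v.primesAbove, ∀ Φ : absoluteGaloisGroup F, IsArithFrobAt (𝓞 F) Φ 𝔓 →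
          (((ψ Φ : GL (Fin 1) ℂ) : Matrix (Fin 1) (Fin 1) ℂ) 0 0) = quadraticSign E v := by
  classical
  -- a quadratic extension is Galois
  haveI : FiniteDimensional F E := Module.finite_of_finrank_pos (by rw [h2]; exact two_pos)
  haveI : Algebra.IsQuadraticExtension F E := ⟨h2⟩
  haveI : IsGalois F E := inferInstance
  have hprime : (Module.finrank F E).Prime := by rw [h2]; exact Nat.prime_two
  -- `H = Gal(F̄/E) ≤ Γ_F`, open of index `2`, normal
  set r := absGaloisRestrict F E with hr
  obtain ⟨hHopen, hHi⟩ := isOpen_range_absGaloisRestrict_and_index F E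
  have hHi2 : r.range.index = 2 := hHi.trans h2
  haveI hHn : r.range.Normal := Subgroup.normal_of_index_eq_two hHi2
  -- the quadratic character `χ_{E/F}` as a rank-one Artin representation
  let θ₀ : absoluteGaloisGroup F →* ℂˣ := signCharOfIndexTwo r.range hHi2
  have hθ₀ker : (θ₀.ker : Set (absoluteGaloisGroup F)) = r.range := by
    rw [ker_signCharOfIndexTwo]
  have hθ₀cont : Continuous θ₀ :=
    MonoidHom.continuous_of_isOpen_ker θ₀ (by rw [hθ₀ker]; exact hHopen)
  let θ : absoluteGaloisGroup F →ₜ* ℂˣ := ⟨θ₀, hθ₀cont⟩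
  let ψ : FramedArtinRep F 1 :=
    ContinuousMonoidHom.comp
      (FramedRep.unitsContinuousMulEquivOfUnique (Fin 1) ℂ : ℂˣ →ₜ* GL (Fin 1) ℂ) θ
  have hψ : ∀ g (i j : Fin 1),
      ((ψ g : GL (Fin 1) ℂ) : Matrix (Fin 1) (Fin 1) ℂ) i j = (θ₀ g : ℂ) := fun g i j => rfl
  have hψ1 : ∀ g, ψ g = 1 ↔ g ∈ r.range := by
    intro g
    constructor
    · intro h
      by_contra hg
      have h1 := congrFun (congrFun (congrArg (fun x : GL (Fin 1) ℂ => (x : Matrix (Fin 1) (Fin 1) ℂ)) h) 0) 0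
      rw [hψ, show θ₀ g = -1 from signCharOfIndexTwo_apply_of_not_mem hHi2 hg,
        Matrix.GeneralLinearGroup.coe_one, Matrix.one_apply_eq, Units.val_neg, Units.val_one] at h1
      norm_num at h1
    · intro hg
      ext i j
      rw [hψ, show θ₀ g = 1 from signCharOfIndexTwo_apply_of_mem hHi2 hg, Units.val_one,
        Matrix.GeneralLinearGroup.coe_one, Subsingleton.elim i j, Matrix.one_apply_eq]
  have hker : IsOpen (ψ.toMonoidHom.ker : Set (absoluteGaloisGroup F)) := by
    have : (ψ.toMonoidHom.ker : Set (absoluteGaloisGroup F)) = r.range := by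
      ext g
      exact hψ1 g
    rw [this]
    exact hHopen
  refine ⟨ψ, ?_⟩
  have hunrψ : ∀ᶠ v in Filter.cofinite, ψ.IsUnramifiedAt v :=
    ψ.eventually_isUnramifiedAt_of_isOpen_ker hker
  have hunrE : ∀ᶠ v : HeightOneSpectrum (𝓞 F) in Filter.cofinite,
      Algebra.IsUnramifiedIn (𝓞 E) v.asIdeal := by
    rw [Filter.eventually_cofinite]
    exact finite_setOf_not_isUnramifiedIn F E
  filter_upwards [hunrψ, hunrE] with v hψv hvE
  refine ⟨hψv, fun 𝔓 h𝔓 Φ hΦ => ?_⟩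
  rw [hψ]
  by_cases hΦH : Φ ∈ r.range
  · -- split: every place above `v` has residue degree `1`
    obtain ⟨c, hc⟩ : ∃ c, c ∉ r.range := by
      by_contra! hall
      have : r.range = ⊤ := eq_top_iff.mpr fun g _ => hall g
      rw [this, Subgroup.index_top] at hHi2
      exact absurd hHi2 (by norm_num)
    obtain ⟨P, 𝔔, τ, hP, hf1, -, -⟩ :=
      exists_places_split_of_mem_range (F := F) (M := E) hprime hHn hHi hc hvE h𝔓 hΦ hΦH
    rw [show θ₀ Φ = 1 from signCharOfIndexTwo_apply_of_mem hHi2 hΦH, Units.val_one]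
    unfold quadraticSign
    rw [if_pos]
    exact ⟨P 0, congrArg HeightOneSpectrum.asIdeal (hP 0).1, hf1 _ (hP 0).1⟩
  · -- inert: one place above `v`, of residue degree `2`
    have hI : 𝔓.inertia (absoluteGaloisGroup F) ≤ r.range := fun g hg =>
      (hψ1 g).mp (hψv 𝔓 h𝔓 g hg)
    obtain ⟨w, -, -, -, huniq, hfw, -⟩ :=
      exists_place_inert_of_not_mem_range (F := F) (M := E) hprime hHn hHi hvE h𝔓 hI hΦ hΦH
    rw [show θ₀ Φ = -1 from signCharOfIndexTwo_apply_of_not_mem hHi2 hΦH, Units.val_neg,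
      Units.val_one]
    unfold quadraticSign
    rw [if_neg]
    rintro ⟨w', hw', hf'⟩
    have hw'v : w'.under (𝓞 F) = v := HeightOneSpectrum.ext hw'
    have := huniq w' hw'v
    subst this
    rw [hfw, h2] at hf'
    exact absurd hf' (by norm_num)

/-- **The Hecke character `ω_{E/F} ∘ N_{K/F}` of an arbitrary finite extension `K/F`, from the
Galois side** (Tate, Cassels–Fröhlich Ch. VII, §4.2 Corollary (iii) with §2.1 and the functoriality
of the reciprocity map under restriction, §5.1 (A); Arthur–Clozel 1989, Ch. 3, §1 (1.1) in rank
one: `t_{Π,w} = t_{π,v}^{f(w|v)}`). For a quadratic extension `E/F` and **any** finite extension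
`K/F` of number fields there is a Hecke character `ω` of `K` of finite order such that, at almost
every finite place `w` of `K`, with `v` the place of `F` below `w`, `ω` is unramified and
`ω(ϖ_w) = ε_{E/F}(v)^{f(w|v)}`. Proof: restrict `χ_{E/F}` (`exists_artinChar_frob_eq_quadraticSign`)
to `Γ_K` and apply Artin reciprocity for characters over `K` — a theorem of the tree,
`GaloisRepresentations.artinReciprocity_character_holds` — to get `ω` with
`ω(ϖ_w) = χ_{E/F}|_{Γ_K}(Frob_w)`; a Frobenius of `Γ_K` at `w` restricts to the `f(w|v)`-th power of
a Frobenius of `Γ_F` at `v` (`FramedGaloisRep.exists_restrictField_apply_eq_pow`), whose value is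
`ε_{E/F}(v)`. [cite: CasselsFrohlichANT1967, Ch. VII §4.2 Corollary (iii), §5.1 (A)]
[cite: ArthurClozelAMS120, Ch. 3, §1 (1.1)] -/
theorem exists_heckeCharacter_quadraticSign_pow (E : Type) [Field E] [NumberField E] [Algebra F E]
    (h2 : Module.finrank F E = 2) (K : Type) [Field K] [NumberField K] [Algebra F K] :
    ∃ ω : HeckeCharacter K, ω.IsFiniteOrder ∧
      ∀ᶠ w : HeightOneSpectrum (𝓞 K) in Filter.cofinite, ∀ v : HeightOneSpectrum (𝓞 F),
        w.asIdeal.under (𝓞 F) = v.asIdeal →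
          ω.IsUnramifiedAt w ∧
            ω.valueAtUniformizer w = quadraticSign E v ^ w.asIdeal.inertiaDeg (𝓞 F) := by
  classical
  obtain ⟨ψ, hψ⟩ := exists_artinChar_frob_eq_quadraticSign (F := F) E h2
  obtain ⟨ω, hfin, hω⟩ :=
    exists_heckeCharacter_apply_frob_eq artinReciprocity_character_holds (ψ.restrictField K)
  refine ⟨ω, hfin, ?_⟩
  filter_upwards [eventually_under (E := K) hψ] with w hw v hwv
  obtain ⟨hψv, hfrob⟩ := hw v hwv
  have hψKw : (ψ.restrictField K).IsUnramifiedAt w := ψ.isUnramifiedAt_restrictField hwv hψv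
  obtain ⟨hunr, hval⟩ := hω w hψKw
  refine ⟨hunr, ?_⟩
  obtain ⟨𝔔, h𝔔⟩ := HeightOneSpectrum.primesAbove_nonempty w
  obtain ⟨τ, hτ⟩ := HeightOneSpectrum.exists_isArithFrobAt_of_mem_primesAbove_holds h𝔔
  rw [← hval 𝔔 h𝔔 τ hτ]
  obtain ⟨𝔓, h𝔓, φ, hφ, heq⟩ := ψ.exists_restrictField_apply_eq_pow hwv hψv h𝔔 hτ
  rw [heq, Units.val_pow_eq_pow_val, matrix_fin_one_pow_apply, hfrob 𝔓 h𝔓 φ hφ]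

end QuadraticCharacter

/-! ### The cuspidality fact from Tunnell's Lemma -/

section Main

open scoped Classical

/-- **Tunnell's Lemma and the dihedral case of the strong Artin conjecture imply the cuspidality
of Tunnell's cubic lifts** — the named fact `tunnell_cuspidal_cubic_lifts` (`TunnellLemma`) from
the named facts `tunnell_lemma` (`TunnellOctahedralGlobal`; Tunnell 1981, Lemma, p. 174: "There
exists a unique index `i` such that `BC_{K/F}(π_i) = π(ρ_K)`") and `strongArtin_of_isDihedralType`
(`StrongArtinGL2`; Jacquet–Langlands §12: `π(ρ_K)` exists since "`ρ_K` is monomial", Tunnell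
p. 174), everything else being theorems of the tree. Proof. Let `π` be cuspidal on `GL_2(𝔸_F)`
lifting weakly to `Π_E = π(σ_E)`. The projective image of `σ_K` has order `8` inside
`\bar σ(Γ_F) ≅ S_4`, so `σ_K` is irreducible of type `D_4`
(`isDihedralType_restrictField_of_card_eq_eight`) and `Π_K = π(σ_K)` is a cuspidal representation of
`GL_2(𝔸_K)`. The cuspidal twist `π₂ = π ⊗ ω_{E/F}` (`exists_twist_quadraticSign_holds`) lifts weakly
to `Π_E` as well (`IsWeakBaseChangeLiftAE.of_twist_quadraticSign`), and `t_{π₂,v} = ε_{E/F}(v) t_{π,v}`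
almost everywhere; by Tunnell's Lemma `Π_K` is a weak base change lift of `π` — and we are done —
or of `π₂`. In the latter case `π` lifts weakly to the cuspidal twist `Π_K ⊗ ω`
(`CuspidalAutomorphicRepData.twist`), `ω = ω_{E/F} ∘ N_{K/F}` the finite-order Hecke character of
`K` with `ω(ϖ_w) = ε_{E/F}(v)^{f(w|v)}` a.e. (`exists_heckeCharacter_quadraticSign_pow`, from Artin
reciprocity over `K`): `t_{Π_K ⊗ ω, w} = ε^{f} (ε t_{π,v})^{f} = t_{π,v}^{f}`
(`AutomorphicRepData.eventually_hasSatakeParamAt_twist`, `ε² = 1`). Hence the leaf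
`tunnell_cuspidal_cubic_lifts` is implied by Tunnell's printed Lemma and the dihedral case.
[cite: Tunnell1981, Lemma (p. 174)] [cite: Gelbart1997, §7.2, Lemma (p. 259)]
[cite: JacquetLanglands1970, §12] -/
theorem tunnell_cuspidal_cubic_lifts_of_tunnell_lemma (hL : tunnell_lemma)
    (hd : strongArtin_of_isDihedralType) : tunnell_cuspidal_cubic_lifts := by
  intro F E K _ _ _ _ _ _ _ _ hdegE hdegK σ hoct hcardE hcardK hF hE hK PE hPE π hl
  obtain ⟨e⟩ := hoct
  -- `Π_K = π(σ_K)` from the dihedral case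
  obtain ⟨hdih, hirrK⟩ := isDihedralType_restrictField_of_card_eq_eight σ e K hcardK
  obtain ⟨hK', PK, hPK⟩ := hd (σ.restrictField K) hirrK hdih
  -- the twist `π₂ = π ⊗ ω_{E/F}` lifts to `Π_E` as well
  obtain ⟨π₂, htw⟩ := exists_twist_quadraticSign_holds 2 F E hdegE hF π
  have hl₂ : IsWeakBaseChangeLiftAE π₂.1 PE.1 :=
    hl.of_twist_quadraticSign hdegE htw (AutomorphicRepData.hasSatakeParamAt_unique_holds _)
      (AutomorphicRepData.hasSatakeParamAt_cofinite_holds _)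
  -- Tunnell's Lemma: `Π_K` is a weak lift of `π` or of `π₂`
  rcases hL F E K hdegE hdegK σ ⟨e⟩ hcardE hcardK hF hE hK PE PK hPE hPK π π₂ hl hl₂ htw with
    h | h
  · exact ⟨PK, h⟩
  · -- `π = π₂ ⊗ ω_{E/F}` lifts to `Π_K ⊗ (ω_{E/F} ∘ N_{K/F})`
    obtain ⟨ω, hfin, hω⟩ := exists_heckeCharacter_quadraticSign_pow (F := F) E hdegE K
    refine ⟨PK.twist ω hfin, ?_⟩
    have A := eventually_under (E := K)
      ((AutomorphicRepData.hasSatakeParamAt_cofinite_holds π.1).and htw)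
    rw [isWeakBaseChangeLiftAE_iff] at h ⊢
    filter_upwards [h, hω, A, PK.1.eventually_hasSatakeParamAt_twist hfin] with w hw hωw hAw htwK
      v α hv hα
    obtain ⟨⟨α₀, hα₀⟩, htwv⟩ := hAw v hv
    have hαα₀ : α = α₀ := AutomorphicRepData.hasSatakeParamAt_unique_holds _ hα hα₀
    subst hαα₀
    have h1 : PK.1.HasSatakeParamAt w
        ((α.map (quadraticSign E v * ·)).map (· ^ w.asIdeal.inertiaDeg (𝓞 F))) :=
      hw v _ hv (htwv α hα)
    have h2 := htwK _ h1
    rw [(hωw v hv).2] at h2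
    have hmul : ((α.map (quadraticSign E v * ·)).map (· ^ w.asIdeal.inertiaDeg (𝓞 F))).map
        (quadraticSign E v ^ w.asIdeal.inertiaDeg (𝓞 F) * ·) =
        α.map (· ^ w.asIdeal.inertiaDeg (𝓞 F)) := by
      rw [Multiset.map_map, Multiset.map_map]
      refine Multiset.map_congr rfl fun t _ => ?_
      simp only [Function.comp_apply, mul_pow]
      rw [← mul_assoc, ← mul_pow, quadraticSign_mul_self, one_pow, one_mul]
    rw [hmul] at h2
    rw [CuspidalAutomorphicRepData.twist_val]
    exact h2

/-- **The cuspidality of Tunnell's cubic lifts from the finer leaves**: `tunnell_cuspidal_cubic_lifts`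
from Tunnell's Lemma (`tunnell_lemma`) and automorphic induction of Hecke characters in prime degree
(`automorphicInduction_character`, Arthur–Clozel Thm. 6.2 / Jacquet–Langlands §12), the dihedral
case of the strong Artin conjecture being reduced to the latter and to Artin reciprocity for
characters — a theorem of the tree — in `LanglandsTunnellMonomial`
(`strongArtin_of_isDihedralType_of_reciprocity_of_induction`). [cite: Tunnell1981, Lemma (p. 174)]
[cite: JacquetLanglands1970, §12] -/
theorem tunnell_cuspidal_cubic_lifts_of_tunnell_lemma_of_induction (hL : tunnell_lemma)
    (hAI : automorphicInduction_character) : tunnell_cuspidal_cubic_lifts :=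
  tunnell_cuspidal_cubic_lifts_of_tunnell_lemma hL
    (strongArtin_of_isDihedralType_of_reciprocity_of_induction
      GaloisRepresentations.artinReciprocity_character_holds hAI)

/-- **The cuspidality of Tunnell's cubic lifts is equivalent to Tunnell's Lemma**, granting
Arthur–Clozel's Thm. III.3.1 (fibres of quadratic base change, `ArthurClozel_fibres_quadratic`) and
the dihedral case of the strong Artin conjecture (`strongArtin_of_isDihedralType`): the forward
direction is the tree's `tunnell_lemma_of_leaves` (`LanglandsTunnellReduction`, Tunnell's own proof
of the Lemma, p. 174), the converse is `tunnell_cuspidal_cubic_lifts_of_tunnell_lemma`. So within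
the decomposition of Tunnell's theorem the leaf `tunnell_cuspidal_cubic_lifts` (the non-normal cubic
base change of Jacquet–Piatetski-Shapiro–Shalika, as used on p. 174) weighs exactly as much as the
Lemma it serves. [cite: Tunnell1981, Lemma (p. 174)] [cite: Gelbart1997, §7.2, Lemma (p. 259)] -/
theorem tunnell_cuspidal_cubic_lifts_iff_tunnell_lemma (ha : ArthurClozel_fibres_quadratic)
    (hd : strongArtin_of_isDihedralType) : tunnell_cuspidal_cubic_lifts ↔ tunnell_lemma :=
  ⟨fun hb => tunnell_lemma_of_leaves ha hb, fun hL => tunnell_cuspidal_cubic_lifts_of_tunnell_lemma hL hd⟩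

end Main

/-! ### The octahedral case implies Tunnell's Lemma: closing the triangle -/

section Apex

open scoped Classical
open Literature.NumberTheory.GaloisRepresentations

variable {F : Type} [Field F] [NumberField F] {L : Type} [Field L] [NumberField L] [Algebra F L]

/-- **`π(σ)` lifts weakly to `π(σ_L)` along any finite extension `L/F`** (the unramified shadow of
"`BC_{L/F}(π(σ)) = π(σ_L)`", Tunnell 1981, p. 174: "`BC_{M/K}(BC_{K/F}(π_i)) = π(ρ_M)`"; Arthur–Clozel
Ch. 3 (1.1)): if `π = π(σ)` on `GL_2(𝔸_F)` and `P = π(σ|_{Γ_L})` on `GL_2(𝔸_L)` (`IsPiOfArtinRep`), then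
`t_{P,w} = β_v^{f(w|v)} = t_{π,v}^{f(w|v)}` at almost every `w` (`β_v` the Frobenius eigenvalues of `σ`
at the place `v` below `w`, `eq_map_pow_of_hasFrobCharpolyAt_restrictField`), i.e. `P` is a weak base
change lift of `π`. No hypothesis on `L/F`. [cite: Tunnell1981, p. 174] [cite: ArthurClozelAMS120, Ch. 3 Def. 1.1] -/
theorem isWeakBaseChangeLiftAE_of_isPiOfArtinRep (σ : FramedArtinRep F 2)
    {hF : isCompact_glFiniteIntegralLevel 2 F} {hL : isCompact_glFiniteIntegralLevel 2 L}
    {π : AutomorphicRepData (AutomorphyDatum.gl 2 F hF)}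
    {P : AutomorphicRepData (AutomorphyDatum.gl 2 L hL)}
    (hπ : IsPiOfArtinRep σ π) (hP : IsPiOfArtinRep (σ.restrictField L) P) :
    IsWeakBaseChangeLiftAE π P := by
  refine (hP.and (eventually_under (E := L) hπ)).mono ?_
  rintro w ⟨⟨γ, hγ, -, hγP⟩, hw⟩ v α hv hα
  obtain ⟨α', hα', hσv, hα'P⟩ := hw v hv
  have hαα' : α = α' := AutomorphicRepData.hasSatakeParamAt_unique_holds _ hα hα'
  subst hαα'
  have e := eq_map_pow_of_hasFrobCharpolyAt_restrictField σ hσv hα.card_eq hα'P hv hγP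
  rw [← e]
  exact hγ

omit [NumberField F] [NumberField L] in
/-- **Transfer of weak lifts along almost-everywhere equal Satake data on the base**: if `P` is a
weak base change lift of `π'` and every Satake parameter of `π'` is one of `π` at almost every place,
then `P` is a weak base change lift of `π` (Satake parameters of `π` being unique and those of `π'`
existing almost everywhere, Flath's theorems). [folklore] -/
theorem IsWeakBaseChangeLiftAE.of_eventually_hasSatakeParamAt [NumberField F] [NumberField L]
    {hF : isCompact_glFiniteIntegralLevel 2 F} {hL : isCompact_glFiniteIntegralLevel 2 L}
    {π π' : AutomorphicRepData (AutomorphyDatum.gl 2 F hF)}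
    {P : AutomorphicRepData (AutomorphyDatum.gl 2 L hL)} (hlift : IsWeakBaseChangeLiftAE π' P)
    (heq : ∀ᶠ v : HeightOneSpectrum (𝓞 F) in Filter.cofinite, ∀ α : Multiset ℂ,
      π'.HasSatakeParamAt v α → π.HasSatakeParamAt v α) :
    IsWeakBaseChangeLiftAE π P := by
  have A := eventually_under (E := L)
    ((AutomorphicRepData.hasSatakeParamAt_cofinite_holds π').and heq)
  refine (hlift.and A).mono ?_
  rintro w ⟨hw, hwA⟩ v α hv hα
  obtain ⟨⟨α₀, hα₀⟩, heqv⟩ := hwA v hv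
  have hαα₀ : α = α₀ := AutomorphicRepData.hasSatakeParamAt_unique_holds _ hα (heqv α₀ hα₀)
  subst hαα₀
  exact hw v α hv hα₀

/-- `S_4` has two non-commuting elements, so a projective image isomorphic to it is not cyclic and a
rank-two representation of octahedral type is irreducible (`isIrreducible_of_not_isCyclicType`).
[folklore] -/
theorem isIrreducible_of_isOctahedralType (σ : FramedArtinRep F 2)
    (hoct : IsOctahedralType σ.toMonoidHom) : σ.toGaloisRep.IsIrreducible := by
  obtain ⟨e⟩ := hoct
  haveI : Finite σ.toMonoidHom.range := finite_range_toMonoidHom σ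
  have hab : Equiv.swap (0 : Fin 4) 1 * Equiv.swap 1 2 ≠ Equiv.swap 1 2 * Equiv.swap 0 1 := by
    decide
  exact (isIrreducible_toStdRepresentation_iff σ).mp
    (isIrreducible_of_not_isCyclicType _ (not_isCyclic_of_mulEquiv_of_ne e hab))

/-- **The octahedral case of the strong Artin conjecture implies Tunnell's Lemma**, granting the
fibres of quadratic base change (Arthur–Clozel III.3.1, `ArthurClozel_fibres_quadratic`) — the
converse of the tree's route `strongArtin_of_isOctahedralType_of_tunnell_lemma` (Tunnell 1981,
pp. 174–175). Proof: `π' = π(σ)` exists (`strongArtin_of_isOctahedralType`; `σ` is irreducible,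
`isIrreducible_of_isOctahedralType`) and lifts weakly to `Π_E = π(σ_E)` and to `Π_K = π(σ_K)`
(`isWeakBaseChangeLiftAE_of_isPiOfArtinRep`); `π'` and `π₁` both lift to `Π_E`, so their Satake
parameters have equal `f(u|v)`-th powers at almost all places `u` of `E`, and by III.3.1 over `E/F`
either `t_{π₁} = t_{π'}` a.e. — then `Π_K` is a weak lift of `π₁`
(`IsWeakBaseChangeLiftAE.of_eventually_hasSatakeParamAt`) — or `t_{π₁} = ε_{E/F} t_{π'}` a.e., and
then `t_{π₂} = ε_{E/F} t_{π₁} = t_{π'}` a.e. (`ε² = 1`) and `Π_K` is a weak lift of `π₂`.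
[cite: Tunnell1981, Lemma (p. 174) and Theorem (p. 175)] [cite: ArthurClozelAMS120, Ch. 3 Thm. 3.1] -/
theorem tunnell_lemma_of_strongArtin_of_isOctahedralType (ho : strongArtin_of_isOctahedralType)
    (ha : ArthurClozel_fibres_quadratic) : tunnell_lemma := by
  intro F E K _ _ _ _ _ _ _ _ hdegE hdegK σ hoct hcardE hcardK hF hE hK PE PK hPE hPK π₁ π₂ hl₁ hl₂
    htw
  -- `π' = π(σ)` and its weak lifts to `Π_E`, `Π_K`
  obtain ⟨hF', π', hπ'⟩ := ho σ (isIrreducible_of_isOctahedralType σ hoct) hoct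
  have hl'E : IsWeakBaseChangeLiftAE π'.1 PE.1 := isWeakBaseChangeLiftAE_of_isPiOfArtinRep σ hπ' hPE
  have hl'K : IsWeakBaseChangeLiftAE π'.1 PK.1 := isWeakBaseChangeLiftAE_of_isPiOfArtinRep σ hπ' hPK
  -- the hypothesis of Arthur–Clozel III.3.1 over `E/F` for `π'` and `π₁`
  have H : ∀ᶠ u : HeightOneSpectrum (𝓞 E) in Filter.cofinite,
      ∀ (v : HeightOneSpectrum (𝓞 F)) (α α' : Multiset ℂ), u.asIdeal.under (𝓞 F) = v.asIdeal →
        π'.1.HasSatakeParamAt v α → π₁.1.HasSatakeParamAt v α' →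
          α.map (· ^ u.asIdeal.inertiaDeg (𝓞 F)) = α'.map (· ^ u.asIdeal.inertiaDeg (𝓞 F)) := by
    refine (hl'E.and hl₁).mono ?_
    rintro u ⟨hu, hu₁⟩ v α α' huv hα hα'
    exact AutomorphicRepData.hasSatakeParamAt_unique_holds _ (hu v α huv hα) (hu₁ v α' huv hα')
  rcases ha 2 F E hdegE hF π' π₁ H with h | h
  · exact Or.inl (hl'K.of_eventually_hasSatakeParamAt h)
  · refine Or.inr (hl'K.of_eventually_hasSatakeParamAt ?_)
    filter_upwards [h, htw] with v hv htwv α hα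
    have h2 := htwv _ (hv α hα)
    rw [Multiset.map_map] at h2
    convert h2 using 2
    conv_lhs => rw [← Multiset.map_id α]
    refine Multiset.map_congr rfl fun t _ => ?_
    simp only [Function.comp_apply, id_eq, ← mul_assoc, quadraticSign_mul_self, one_mul]

/-- **The octahedral case and Tunnell's Lemma are equivalent**, granting the tetrahedral and dihedral
cases of the strong Artin conjecture, cyclic descent of prime degree and the fibres of quadratic base
change: forward by `tunnell_lemma_of_strongArtin_of_isOctahedralType`, backward by Tunnell's proof
(`strongArtin_of_isOctahedralType_of_tunnell_lemma`, `TunnellOctahedralGlobal`) with the quadratic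
twist (`exists_twist_quadraticSign_holds`) and Flath's Satake facts supplied as theorems.
[cite: Tunnell1981, Lemma (p. 174) and Theorem (pp. 174–175)] -/
theorem strongArtin_of_isOctahedralType_iff_tunnell_lemma (ht : strongArtin_of_isTetrahedralType)
    (hd : strongArtin_of_isDihedralType) (hdesc : cuspidal_descent_cyclic)
    (ha : ArthurClozel_fibres_quadratic) : strongArtin_of_isOctahedralType ↔ tunnell_lemma :=
  ⟨fun ho => tunnell_lemma_of_strongArtin_of_isOctahedralType ho ha, fun hL =>
    strongArtin_of_isOctahedralType_of_tunnell_lemma ht hd hdesc exists_twist_quadraticSign_holds hL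
      (fun π => AutomorphicRepData.hasSatakeParamAt_unique_holds π)
      (fun π => AutomorphicRepData.hasSatakeParamAt_cofinite_holds π)⟩

/-- **The octahedral case implies the cuspidality of Tunnell's cubic lifts**, granting the fibres of
quadratic base change and the dihedral case: `tunnell_cuspidal_cubic_lifts_of_tunnell_lemma` after
`tunnell_lemma_of_strongArtin_of_isOctahedralType`. Together with the tree's
`strongArtin_of_isOctahedralType_of_leaves` (`LanglandsTunnellReduction`), the three named facts
`strongArtin_of_isOctahedralType`, `tunnell_lemma` and `tunnell_cuspidal_cubic_lifts` are equivalent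
modulo the tetrahedral and dihedral cases, cyclic descent and Arthur–Clozel III.3.1: the leaf carries
exactly the octahedral content of the Langlands–Tunnell theorem.
[cite: Tunnell1981, Theorem [4] (p. 173), Lemma (p. 174), Theorem (p. 175)] -/
theorem tunnell_cuspidal_cubic_lifts_of_strongArtin_of_isOctahedralType
    (ho : strongArtin_of_isOctahedralType) (ha : ArthurClozel_fibres_quadratic)
    (hd : strongArtin_of_isDihedralType) : tunnell_cuspidal_cubic_lifts :=
  tunnell_cuspidal_cubic_lifts_of_tunnell_lemma (tunnell_lemma_of_strongArtin_of_isOctahedralType ho ha) hd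

end Apex

end Literature.NumberTheory.Automorphic

end
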